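import Literature.NumberTheory.Automorphic.WhittakerCoeffLevelOneNonvanishing
import Literature.NumberTheory.Automorphic.WhittakerCoeffTranslateUnramified
import Literature.NumberTheory.Automorphic.UnipotentConjHaarChar
import HarnessLib

/-!
# Non-vanishing of the translated Whittaker coefficient of a cusp form of level supported on `S` at a
# point integral outside `S`

Topic `NumberTheory/Automorphic`; namespace `Literature.NumberTheory.Automorphic`. Theorems only.
`exists_whittakerCoeff_smoothedForm_translate_ne_zero_sndHom_mem_glFiniteIntegralLevel`
(`WhittakerCoeffLevelOneTranslateNonvanishing`) shows, for a LEVEL-ONE cusp form, that the translated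
global Whittaker coefficient `W(diag(τ) g)` is non-zero at a point with integral finite part. Here the
same peeling argument is run only at the places OUTSIDE a set `S`: for a cuspidal `Π` with a Satake
family off `S`, a test function `η` left invariant under `K(𝔫)` with `𝔫` prime to every `v ∉ S`,
`f ∈ Π` with `S_η f ≠ 0`, and a torus element `τ` whose `v`-component at every `v ∉ S` is a diagonal
shift of constant ratio `a_v` with `ψ_{K,v}(a_v ·)` of conductor `𝒪_v`, there is `g` whose
`v`-components are integral for all `v ∉ S` and with `W(diag(τ) g) ≠ 0`
(`exists_whittakerCoeff_smoothedForm_translate_ne_zero_forall_not_mem`). The abstract iteration is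
`exists_apply_ne_zero_forall_not_mem_localComponent_mem_glInt`: the unramified torus structure of
`W^τ = W(diag τ ·)` at `v ∉ S` (`exists_isTorusUnramifiedAt_whittakerCoeff_smoothedForm_translate`)
and the `N_n`-equivariance up to scalars let one replace `g` by `stripAt v g` without losing
`W^τ ≠ 0`, one non-integral place `v ∉ S` at a time. (Cogdell (2004), §1.1, §3.1; Shalika (1974),
Thm. 5.9: genericity; the device is needed for the bad-place data of Corollaire (i)(b) of
Mœglin–Waldspurger.)

## References

* J. W. Cogdell, *Analytic theory of L-functions for GL_n* (2004), §1.1, §3.1 Thm. 3.3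
  [CogdellAnalyticTheory2004].
* J. A. Shalika, *The multiplicity one theorem for GL_n*, Ann. of Math. 100 (1974), §5 Thm. 5.9
  [Shalika1974].
-/

noncomputable section

open MeasureTheory Measure NumberField IsDedekindDomain Matrix Set ValuativeRel
open scoped MatrixGroups ComplexConjugate
open Literature.NumberTheory.GaloisRepresentations (ideleGroup localUnits)

namespace Literature.NumberTheory.Automorphic

section TranslateOutside

variable {n : ℕ} {K : Type} [Field K] [NumberField K]
  {μ : Measure (AdelicGroupData.gl n K).automorphicQuotient} [(AdelicGroupData.gl n K).IsAutomorphicMeasure μ]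

variable [MeasurableSpace (AdeleRing (𝓞 K) K)] [BorelSpace (AdeleRing (𝓞 K) K)]
variable [MeasurableSpace (GL (Fin n) (AdeleRing (𝓞 K) K))] [BorelSpace (GL (Fin n) (AdeleRing (𝓞 K) K))]

/-! ### Iterated peeling outside `S` (abstract) -/

omit [(AdelicGroupData.gl n K).IsAutomorphicMeasure μ] [MeasurableSpace (AdeleRing (𝓞 K) K)] [BorelSpace (AdeleRing (𝓞 K) K)]
  [MeasurableSpace (GL (Fin n) (AdeleRing (𝓞 K) K))] [BorelSpace (GL (Fin n) (AdeleRing (𝓞 K) K))] in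
/-- **Iterated peeling outside `S`.** If `W` is an unramified Whittaker–Hecke datum at every finite place
`v ∉ S` (with the scalar behaviour under `ι_v(N_n(K_v))` and under the central elements
`ι_v((ϖ_v 1)^{-N})` of `apply_stripAt_ne_zero`), then from one `g₀` with `W(g₀) ≠ 0` one gets `g`,
integral at every finite place outside `S` and with the same components as `g₀` at the places of `S`,
with `W(g) ≠ 0` (induction on the finite number of non-integral places of `g₀` outside `S`). [folklore] -/
theorem exists_apply_ne_zero_forall_not_mem_localComponent_mem_glInt {W : GL (Fin n) (AdeleRing (𝓞 K) K) → ℂ}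
    (S : Set (HeightOneSpectrum (𝓞 K)))
    (hT : ∀ v ∉ S, ∃ (ϖ : (v.adicCompletion K)ˣ) (x : Fin n → ℂ),
      IsTorusUnramifiedAt n K W v ϖ x ∧
        ∀ (N : ℕ) (g : GL (Fin n) (AdeleRing (𝓞 K) K)),
          ∃ c : ℂ, W (g * GLn.ofLocal n K v ((heckeDiag n ϖ n)⁻¹ ^ N)) = c * W g)
    (hN : ∀ v ∉ S, ∀ u ∈ upperUnitriangular (Fin n) (v.adicCompletion K),
      ∀ g : GL (Fin n) (AdeleRing (𝓞 K) K), ∃ c : ℂ, W (GLn.ofLocal n K v u * g) = c * W g)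
    {g₀ : GL (Fin n) (AdeleRing (𝓞 K) K)} (hg₀ : W g₀ ≠ 0) :
    ∃ g : GL (Fin n) (AdeleRing (𝓞 K) K),
      (∀ v ∉ S, localComponent v g ∈ glInt n (v.adicCompletion K)) ∧
      (∀ v ∈ S, localComponent v g = localComponent v g₀) ∧ W g ≠ 0 := by
  classical
  -- induction on the number of non-integral places outside `S`
  suffices h : ∀ (N : ℕ) (g : GL (Fin n) (AdeleRing (𝓞 K) K)),
      {v : HeightOneSpectrum (𝓞 K) | v ∉ S ∧ localComponent v g ∉ glInt n (v.adicCompletion K)}.ncard ≤ N →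
        W g ≠ 0 → ∃ g' : GL (Fin n) (AdeleRing (𝓞 K) K),
          (∀ v ∉ S, localComponent v g' ∈ glInt n (v.adicCompletion K)) ∧
          (∀ v ∈ S, localComponent v g' = localComponent v g) ∧ W g' ≠ 0 from
    h _ g₀ le_rfl hg₀
  have hfinS : ∀ g : GL (Fin n) (AdeleRing (𝓞 K) K),
      {v : HeightOneSpectrum (𝓞 K) | v ∉ S ∧ localComponent v g ∉ glInt n (v.adicCompletion K)}.Finite := fun g =>
    (finite_setOf_localComponent_not_mem_glInt g).subset fun v hv => hv.2
  intro N
  induction N with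
  | zero =>
    intro g hcard hg
    refine ⟨g, fun v hvS => ?_, fun v _ => rfl, hg⟩
    by_contra hv
    have hmem : v ∈ {v : HeightOneSpectrum (𝓞 K) | v ∉ S ∧ localComponent v g ∉ glInt n (v.adicCompletion K)} := ⟨hvS, hv⟩
    have hpos : 0 < {v : HeightOneSpectrum (𝓞 K) | v ∉ S ∧ localComponent v g ∉ glInt n (v.adicCompletion K)}.ncard :=
      Set.ncard_pos (hfinS g) |>.2 ⟨v, hmem⟩
    omega
  | succ N ih =>
    intro g hcard hg
    by_cases hall : ∀ v ∉ S, localComponent v g ∈ glInt n (v.adicCompletion K)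
    · exact ⟨g, hall, fun v _ => rfl, hg⟩
    push Not at hall
    obtain ⟨v, hvS, hv⟩ := hall
    obtain ⟨ϖ, x, hTv, hCv⟩ := hT v hvS
    have hg₁ : W (GLn.stripAt v g) ≠ 0 := apply_stripAt_ne_zero hTv (hN v hvS) hCv hg
    -- the bad set of `stripAt v g` is the bad set of `g` minus `v`
    have hsub : {w : HeightOneSpectrum (𝓞 K) | w ∉ S ∧ localComponent w (GLn.stripAt v g) ∉ glInt n (w.adicCompletion K)} ⊆
        {w : HeightOneSpectrum (𝓞 K) | w ∉ S ∧ localComponent w g ∉ glInt n (w.adicCompletion K)} \ {v} := by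
      intro w hw
      have hwv : w ≠ v := by
        intro h
        subst h
        apply hw.2
        rw [localComponent_stripAt_self]
        exact one_mem _
      refine ⟨⟨hw.1, ?_⟩, hwv⟩
      have hw2 := hw.2
      rw [localComponent_stripAt_of_ne hwv] at hw2
      exact hw2
    have hmem : v ∈ {w : HeightOneSpectrum (𝓞 K) | w ∉ S ∧ localComponent w g ∉ glInt n (w.adicCompletion K)} := ⟨hvS, hv⟩
    have h1 := Set.ncard_le_ncard hsub (hfinS g).sdiff
    rw [Set.ncard_sdiff_singleton_of_mem hmem] at h1
    have hcard' : {w : HeightOneSpectrum (𝓞 K) | w ∉ S ∧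
        localComponent w (GLn.stripAt v g) ∉ glInt n (w.adicCompletion K)}.ncard ≤ N := by omega
    obtain ⟨g', hg'int, hg'S, hg'ne⟩ := ih (GLn.stripAt v g) hcard' hg₁
    refine ⟨g', hg'int, fun w hw => ?_, hg'ne⟩
    have hwv : w ≠ v := fun h => hvS (h ▸ hw)
    rw [hg'S w hw, localComponent_stripAt_of_ne hwv]

/-! ### The translated Whittaker coefficient of a cusp form of level supported on `S` -/

/-- **The translated Whittaker coefficient of a smoothed cusp form of level supported on `S` is non-zero
at a point integral outside `S`.** Let `Π` be a cuspidal automorphic representation of `GL_n(𝔸_K)`,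
`n ≥ 1`, with a Satake family `α` off `S`, `η` a test function left invariant under `K(𝔫)` with `𝔫 ≠ 0`
prime to every `v ∉ S`, `f ∈ Π` with `S_η f ≠ 0`, and `τ ∈ (𝔸_Kˣ)ⁿ` a torus element whose `v`-component
at every finite `v ∉ S` is `diag(d)` with constant ratios `a_v`, `ψ_{K,v}(a_v ·)` of conductor `𝒪_v`.
Then `W_{S_η f}(diag(τ) g) ≠ 0` for some `g` with `g_v ∈ GL_n(𝒪_v)` for every `v ∉ S`.
[cite: CogdellAnalyticTheory2004, §1.1 and §3.1 Thm. 3.3] [cite: Shalika1974, §5 Thm. 5.9] -/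
theorem exists_whittakerCoeff_smoothedForm_translate_ne_zero_forall_not_mem (hn : 1 ≤ n)
    (P : CuspidalAutomorphicRepGL n K μ) {S : Set (HeightOneSpectrum (𝓞 K))} {α : SatakeFamily K}
    (hα : IsSatakeFamilyOf P S α)
    (ν₀ : Measure ↥(adelicUnipotent n K)) [IsHaarMeasure ν₀]
    {𝔫 : Ideal (𝓞 K)} (h𝔫 : 𝔫 ≠ 0) (hS𝔫 : ∀ v ∉ S, ¬ v.asIdeal ∣ 𝔫)
    {η : (AdelicGroupData.gl n K).Adelic → ℝ} (hη : IsTestFunctionGL n K η)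
    (hηK : ∀ k : (AdelicGroupData.gl n K).Adelic, k ∈ principalCongruenceLevel n K 𝔫 →
      ∀ g : (AdelicGroupData.gl n K).Adelic, η (k * g) = η g)
    (f : P.1.toSubmodule) (hne : smoothedForm η (f : (AdelicGroupData.gl n K).L2 μ) ≠ 0)
    (τ : Fin n → ideleGroup K)
    (hτψ : ∀ v ∉ S, ∃ (d : Fin n → (v.adicCompletion K)ˣ) (a : (v.adicCompletion K)ˣ),
      localComponent v (glDiagonal n (AdeleRing (𝓞 K) K) τ) = diagonalGL (Fin n) (v.adicCompletion K) d ∧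
      (∀ i j : Fin n, (i : ℕ) + 1 = j →
        (d i : v.adicCompletion K) * ((d j)⁻¹ : (v.adicCompletion K)ˣ) = a) ∧
      (∀ c ∈ 𝒪[v.adicCompletion K], (adeleAddChar K).adicComponent v (a * c) = 1) ∧
      ∀ ϖ : v.adicCompletion K, Valued.v ϖ = WithZero.exp (-1 : ℤ) →
        ∃ c ∈ 𝒪[v.adicCompletion K], (adeleAddChar K).adicComponent v (a * (ϖ⁻¹ * c)) ≠ 1) :
    ∃ g : GL (Fin n) (AdeleRing (𝓞 K) K), (∀ v ∉ S, localComponent v g ∈ glInt n (v.adicCompletion K)) ∧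
      whittakerCoeff ν₀ (unipotentTateDomain n K) (adeleAddChar K)
        (invQuot (AdelicGroupData.gl n K) (smoothedForm η (f : (AdelicGroupData.gl n K).L2 μ)))
        (glDiagonal n (AdeleRing (𝓞 K) K) τ * g) ≠ 0 := by
  classical
  haveI := isMulRightInvariant_of_isHaarMeasure_adelicUnipotent ν₀
  have hψ : IsGlobalAddChar K (adeleAddChar K) := isGlobalAddChar_adeleAddChar (K := K)
  have h𝓕 : IsFundamentalDomain ↥(rationalUnipotent n K) (unipotentTateDomain n K) ν₀ :=
    isFundamentalDomain_unipotentTateDomain ν₀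
  have h𝓕c : IsCompact (closure (unipotentTateDomain n K)) := isCompact_closure_unipotentTateDomain
  set φ : GL (Fin n) (AdeleRing (𝓞 K) K) → ℂ :=
    invQuot (AdelicGroupData.gl n K) (smoothedForm η (f : (AdelicGroupData.gl n K).L2 μ)) with hφ
  have hφinv : IsLeftInvariant (AdelicGroupData.gl n K) φ := isLeftInvariant_invQuot _ _
  set W : GL (Fin n) (AdeleRing (𝓞 K) K) → ℂ :=
    whittakerCoeff ν₀ (unipotentTateDomain n K) (adeleAddChar K) φ with hW
  set D : GL (Fin n) (AdeleRing (𝓞 K) K) := glDiagonal n (AdeleRing (𝓞 K) K) τ with hD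
  set WT : GL (Fin n) (AdeleRing (𝓞 K) K) → ℂ := fun g => W (D * g) with hWT
  -- genericity: `W(g₀) ≠ 0`, so `W^τ(D⁻¹ g₀) ≠ 0`
  obtain ⟨g₀, hg₀⟩ := exists_whittakerCoeff_invQuot_smoothedForm_ne_zero_of_one_le hn hη.continuous
    hη.hasCompactSupport (P.le_cuspidalSubspace f.2) hne ν₀
  have hg₀' : WT (D⁻¹ * g₀) ≠ 0 := by
    show W (D * (D⁻¹ * g₀)) ≠ 0
    rwa [mul_inv_cancel_left]
  -- the central character
  obtain ⟨ω, -, -, -, -, -, hωφ⟩ := P.exists_centralCharacter_smoothedForm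
  -- the unramified structure of `W^τ` at every finite place outside `S`
  have hT : ∀ v ∉ S, ∃ (ϖ : (v.adicCompletion K)ˣ) (x : Fin n → ℂ),
      IsTorusUnramifiedAt n K WT v ϖ x ∧
        ∀ (N : ℕ) (g : GL (Fin n) (AdeleRing (𝓞 K) K)),
          ∃ c : ℂ, WT (g * GLn.ofLocal n K v ((heckeDiag n ϖ n)⁻¹ ^ N)) = c * WT g := by
    intro v hvS
    obtain ⟨x, hx⟩ := exists_univ_val_map_eq (hα.card_eq hvS)
    obtain ⟨d, a, hTv, hd, hψa, hψa'⟩ := hτψ v hvS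
    obtain ⟨ϖ, hTu⟩ := exists_isTorusUnramifiedAt_whittakerCoeff_smoothedForm_translate P hα h𝔫 hvS (hS𝔫 v hvS)
      hη.continuous hη.hasCompactSupport hηK f hx h𝓕 h𝓕c hψ hTv hd hψa hψa'
    refine ⟨ϖ, x, hTu, fun N g => ?_⟩
    -- `ι_v((ϖ 1)^{-N})` is the global scalar matrix of the idele `(localUnits v ϖ)^{-N}`
    set w : ideleGroup K := (localUnits v ϖ)⁻¹ ^ N with hw
    have hsc : GLn.ofLocal n K v ((heckeDiag n ϖ n)⁻¹ ^ N) = Matrix.GeneralLinearGroup.scalar (Fin n) w := by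
      rw [map_pow, map_inv, heckeDiag_self_eq_scalar, ← glDiagonal_const_eq_scalar, ofLocal_glDiagonal_const,
        hw, map_pow, map_inv]
    have hcomm : ∀ y : GL (Fin n) (AdeleRing (𝓞 K) K),
        y * Matrix.GeneralLinearGroup.scalar (Fin n) w = Matrix.GeneralLinearGroup.scalar (Fin n) w * y :=
      fun y => (Subgroup.mem_center_iff.1 (generalLinearGroup_scalar_mem_center (n := n) (K := K) w)) y
    have h : ∀ u : GL (Fin n) (AdeleRing (𝓞 K) K),
        φ (u * (D * (g * Matrix.GeneralLinearGroup.scalar (Fin n) w))) = ((ω w : ℂˣ) : ℂ) * φ (u * (D * g)) :=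
      fun u => by
      rw [← mul_assoc D, hcomm (D * g), ← mul_assoc, hcomm u, mul_assoc]
      exact hωφ η f w (u * (D * g))
    refine ⟨((ω w : ℂˣ) : ℂ), ?_⟩
    show W (D * (g * GLn.ofLocal n K v ((heckeDiag n ϖ n)⁻¹ ^ N))) = _ * W (D * g)
    rw [hsc]
    simp only [hW, whittakerCoeff_def, h, mul_assoc]
    rw [integral_const_mul]
    exact (mul_smul_comm _ _ _).symm
  -- `N_n(𝔸_K)`-equivariance of `W^τ` under `ι_v(N_n(K_v))`: conjugate the unipotent past `diag(τ)`
  have hN : ∀ v ∉ S, ∀ u ∈ upperUnitriangular (Fin n) (v.adicCompletion K),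
      ∀ g : GL (Fin n) (AdeleRing (𝓞 K) K), ∃ c : ℂ, WT (GLn.ofLocal n K v u * g) = c * WT g := by
    intro v _ u hu g
    set U : ↥(adelicUnipotent n K) := unipotentDiagConj τ ⟨GLn.ofLocal n K v u, ofLocal_mem_adelicUnipotent hu⟩
      with hU
    have hconj : D * (GLn.ofLocal n K v u * g) = (U : GL (Fin n) (AdeleRing (𝓞 K) K)) * (D * g) := by
      rw [hU, coe_unipotentDiagConj]
      simp only [hD, mul_assoc, inv_mul_cancel_left]
    refine ⟨whittakerCharFun (adeleAddChar K) U, ?_⟩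
    show W (D * (GLn.ofLocal n K v u * g)) = _ * W (D * g)
    rw [hconj]
    exact whittakerCoeff_unipotent_mul h𝓕 hψ hφinv U (D * g)
  obtain ⟨g, hgint, -, hg⟩ := exists_apply_ne_zero_forall_not_mem_localComponent_mem_glInt S hT hN hg₀'
  exact ⟨g, hgint, hg⟩

end TranslateOutside

end Literature.NumberTheory.Automorphic
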